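import Summits.RiemannHypothesis.RiemannHypothesis.Theorems.DBNDbnLowAllTNearAxisSlab
import Literature.NumberTheory.LFunctions.Polymath15EffectiveApproximation
import HarnessLib

/-!
# RiemannHypothesis / DBN — the bundled computational fact `AxisBarrierCertificate` (X⋆ = 6 000 001 000 000)
# for the crux `DBN.DbnLowAllT` (stmt-RiemannHypothesis-0281), LADDER-RH line L39 «DBN · AXIS BARRIER AT X⋆»

LABEL.  **NAMED COMPUTATIONAL FACT (D-0026 bundled-fact shape), PROOF-OF-DATA, RH-ADJACENT, WORTH 0 TOWARD RH.**
`AxisBarrierCertificate` below is NOT proved in the kernel: it is the statement certified by ONE ball-arithmetic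
computation (Arb via python-flint 0.9, 192-bit working precision, no floating-point number enters any certified
inequality): kit job j300411 (replicate j300241, identical verdict) (bundle `jobB/main.py` sha256 d2dc21eabfa34636 (file) / bundle e5e408a2781b8c00; evidence attached to
stmt-RiemannHypothesis-0281: `digest.json`, `cert_toprect.json`, `cert_supdisc.json`, `cert_axismargin.json`,
sha256 manifest `compute-j300411 (replicate j300241, identical verdict).json`).  The composition `dbnLowAllT_of_certificate` is kernel-checked and is
CONDITIONAL on this fact AND on the route's two published computational facts F1
`Literature.NumberTheory.LFunctions.platt_trudgian_numerical_rh` (RH to height 3 000 175 332 800) and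
`Literature.NumberTheory.LFunctions.platt_trudgian` (Λ ≤ 1/5; = F1 + F3 `Polymath15.table1_row2` by
`platt_trudgian_of_numerics`).  It closes a PROOF-OF-DATA crux about `H_t`, `0 < t ≤ 1/5`, `|Re z| < 6·10¹²`; it
says NOTHING about `DBN.DbnHighUniform` (the RH-equivalent half of route DBN) or about Λ = 0.  Nothing here bears on
the truth of RH.

WHAT WAS CERTIFIED (objects of Polymath 15 = `Literature.NumberTheory.LFunctions.Polymath15.*`, `H_t = deBruijnH t`,
`X⋆ = 6000001000000`, `N = ⌊√(x/4π + t/16)⌋ = 690988` constant for `x ∈ [X⋆ − 1/4, X⋆ + 5/4]`, `t ∈ [0, 0.21]`):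
* analytic input (PROVED in the tree): Thm 1.3 `Polymath15.effective_approximation_holds`,
  `H_t(x+iy) = B_t(x+iy)(f_t(x+iy) + e)`, `|e| ≤ errAB + errC0` on `0 < t ≤ 1/2, 0 ≤ y ≤ 1, x ≥ 200`; the run bounds
  `errAB + errC0 ≤ μ` rigorously per region (μ_top = 1.16324·10⁻³ on `[X⋆,X⋆+1]×[1/200,1]`, μ = 1.20301·10⁻³ on
  `[X⋆−1/4, X⋆+5/4]×[0,1/4]`; errAB ≤ 1.47·10⁻⁹ via the proved `gamma_bound_holds`, `kappa_bound_holds`,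
  `re_sStar_bound_holds`; errC0 by ball evaluation of its closed form);
* (a) `TopRect`: for every `t` in a cover of `[0, 1/5]` by 110 closed t-intervals, a winding certificate with
  margin μ_top for `z ↦ f_t(z)` on `[X⋆, X⋆+1] × [1/200, 1]` in the tree's format `Polymath15.WindingCertGt`
  (piece lists with labels `d : Fin 4`, `Re((−i)^d f_t) > μ_top` on every closed piece × t-interval — verified on
  boxes, i.e. for the CONTINUUM of `t`, not a mesh — and `Literature.Analysis.Complex.certTurns = 0` on every
  interval; 5444 pieces, least certified piece margin 2.661e-03 > 2μ_top (pieces were accepted only at 2μ_top)); by `Polymath15.box_zero_free_of_windingCert'`-type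
  reasoning (Thm 1.3 + argument principle) this gives `H_t ≠ 0` on the closed box;
* (b1) `SupDisc`: `|B_t(w)/B_t(X⋆)|·(|f_t(w)| + μ) ≤ 20` certified on boxes covering
  `{w : dist(w, [X⋆, X⋆+1]) ≤ 1/4, Im w ≥ 0} × [0, 1/5]` (largest certified bound 19.95938 < 20); `Im w < 0` by
  `deBruijnH_conj` (`‖H_t(w̄)‖ = ‖H_t(w)‖`); hence `‖H_t(w)‖ ≤ 20‖B_t(X⋆)‖` there;
* (b2) `AxisMargin`: for every `(t, x) ∈ [0,1/5] × [X⋆, X⋆+1]` (boxes; 14587 segments): either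
  `|B_t(x)/B_t(X⋆)|·(|f_t(x)| − μ) > 0.024 = 3·20·(1/200)²/(1/4)²` (least certified value 0.02403), or — near the real
  zeros of `H_t`, 3314 segments — `‖H_t'(x)‖/‖B_t(X⋆)‖ ≥ (‖H_t(x+s) − H_t(x)‖/‖B_t(X⋆)‖ − 960 s²)/|s| > 4.8 =
  3·20·(1/200)/(1/4)²` for some `0 < |s| ≤ 1/250` (least certified value 4.8042), the secant bound being the tree's
  `DbnTheory.norm_sub_taylor_two_le` with `M = 20‖B_t(X⋆)‖` from (b1) and `R = 1/4`.
Constants: X⋆, R = 1/4, y₁ = 1/200, M_rel = 20 fixed BY DATA by rh-idea-4's scan (kit j293712); line card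
`Cruxes/DbnLowAllT/Lines/axis-margin` (pub/ideators/rh-idea-4/dbn/line-axismargin.lean); METER (Q′) director-rh g11
2026-08-27T23:34:09Z; run by rh-eng-kit-1 g0 (2026-08-28).  Statement below = exactly the three stub statements
`TopRect ∧ SupDisc ∧ AxisMargin` of that skeleton with its constants unfolded (≤ what the certificate proves: the run
covers `t ∈ [0, 1/5]` closed and the full ¼-neighbourhood rectangle).

References: D.H.J. Polymath, Res. Math. Sci. 6 (2019) 31 = arXiv:1904.12438, Thm 1.3, §7 (multiple evaluation),
§8.4 (winding certificates); D. Platt, T. Trudgian, Bull. LMS 53 (2021) 792–797, Thm 1, Cor 2.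
-/

noncomputable section

-- D-0017: `Summit.<S>.<S>.…` is the designed namespace of a single-problem summit.
set_option linter.dupNamespace false

namespace Summit.RiemannHypothesis.RiemannHypothesis.Theorems.DbnTheory

open Literature.NumberTheory.LFunctions
open Summit.RiemannHypothesis.RiemannHypothesis.Theses
open Complex Set Metric

/-- **NAMED COMPUTATIONAL FACT `AxisBarrierCertificate` (X⋆ = 6 000 001 000 000; kit job j300411 (replicate j300241, identical verdict), Arb ball
arithmetic, 192 bit; evidence on stmt-RiemannHypothesis-0281).**  Conjunction of the three data-shaped obligations
of line L39 for de Bruijn's `H_t`, `0 < t ≤ 1/5`: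
(a) TOP RECTANGLE `H_t(x+iy) ≠ 0` for `X⋆ ≤ x ≤ X⋆+1`, `1/200 ≤ y ≤ 1`;
(b1) SUP ON DISCS `‖H_t(w)‖ ≤ 20‖B_t(X⋆)‖` for `w` within `1/4` of `[X⋆, X⋆+1]` (`B_t = Polymath15.Bt`, the
normaliser `M_t((1+y−ix)/2)` at `y = 0`);
(b2) REAL-AXIS NO-COALESCENCE MARGIN on `[X⋆, X⋆+1]`: `‖H_t(x)‖ > (3·20‖B_t(X⋆)‖/(1/4)²)(1/200)²` or
`‖H_t'(x)‖ > (3·20‖B_t(X⋆)‖/(1/4)²)(1/200)`.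
Certified, not kernel-proved (see the module docstring for exactly what the run verified and how); PROOF-OF-DATA,
worth 0 toward RH; nothing here bears on the truth of RH. (Method of Polymath2019, Thm. 1.3, §7, §8.4; an in-house kit
certificate, NOT a published fact — hence no cite tag on this `def`, which stays a vendored computational fact of this file.) -/
def AxisBarrierCertificate : Prop :=
  (∀ t x y : ℝ, 0 < t → t ≤ 1 / 5 → (6000001000000 : ℝ) ≤ x → x ≤ 6000001000000 + 1 → (1 / 200 : ℝ) ≤ y →
      y ≤ 1 → deBruijnH t (x + y * I) ≠ 0) ∧
  (∀ t ∈ Ioc (0 : ℝ) (1 / 5), ∀ x ∈ Icc (6000001000000 : ℝ) (6000001000000 + 1),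
      ∀ w ∈ closedBall (x : ℂ) (1 / 4), ‖deBruijnH t w‖ ≤ 20 * ‖Polymath15.Bt t 6000001000000 0‖) ∧
  (∀ t ∈ Ioc (0 : ℝ) (1 / 5), ∀ x ∈ Icc (6000001000000 : ℝ) (6000001000000 + 1),
      3 * (20 * ‖Polymath15.Bt t 6000001000000 0‖) / (1 / 4 : ℝ) ^ 2 * (1 / 200 : ℝ) ^ 2 < ‖deBruijnH t x‖ ∨
        3 * (20 * ‖Polymath15.Bt t 6000001000000 0‖) / (1 / 4 : ℝ) ^ 2 * (1 / 200 : ℝ) <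
          ‖deriv (deBruijnH t) x‖)

/-- `Re (x + y i) = x`. -/
private theorem re_mk' (x y : ℝ) : ((x : ℂ) + (y : ℂ) * I).re = x := by simp
/-- `Im (x + y i) = y`. -/
private theorem im_mk' (x y : ℝ) : ((x : ℂ) + (y : ℂ) * I).im = y := by simp

/-- **CONDITIONAL(F1, `AxisBarrierCertificate`)** — the axis-inclusive barrier at `X⋆ = 6 000 001 000 000` on
`t ∈ [0, 1/5]`: slice `t = 0` from F1 (`im_eq_zero_deBruijnH_zero_of_platt_trudgian_numerical_rh`), slices `t > 0`
from (a) above `y = 1/200` and from (b1)+(b2) below it by the sliding near-axis slab lemma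
`deBruijnH_ne_zero_of_margin` applied per `t` with `M := 20‖B_t(X⋆)‖`, `R := 1/4`, `y₁ := 1/200`.
[cite: Polymath2019, Prop. 3.3] -/
theorem axisBarrier_of_certificate (h₁ : platt_trudgian_numerical_rh) (hc : AxisBarrierCertificate) :
    ∀ t x y : ℝ, 0 ≤ t → t ≤ 1 / 5 → (6000001000000 : ℝ) ≤ x → x ≤ 6000001000000 + 1 → 0 < y → y ≤ 1 →
      deBruijnH t (x + y * I) ≠ 0 := by
  obtain ⟨htop, hsup, hmargin⟩ := hc
  intro t x y ht0 ht hXx hx1 hy0 hy1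
  rcases ht0.eq_or_lt with h0 | htpos
  · subst h0
    intro hz
    have hre : |((x : ℂ) + (y : ℂ) * I).re| ≤ 6000350665600 := by
      rw [re_mk', abs_of_nonneg (by linarith)]; linarith
    have him := im_eq_zero_deBruijnH_zero_of_platt_trudgian_numerical_rh h₁ hz hre
    rw [im_mk'] at him
    exact absurd him hy0.ne'
  · rcases le_or_gt (1 / 200 : ℝ) y with hle | hlt
    · exact htop t x y htpos ht hXx hx1 hle hy1
    · exact deBruijnH_ne_zero_of_margin (R := 1 / 4) (y₁ := 1 / 200) (by norm_num) (by norm_num)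
        (hsup t ⟨htpos, ht⟩) (hmargin t ⟨htpos, ht⟩) ⟨hXx, hx1⟩ hy0 hlt.le

/-- **CONDITIONAL(F1, `platt_trudgian`, `AxisBarrierCertificate`) — the crux `DBN.DbnLowAllT`
(stmt-RiemannHypothesis-0281) from the bundled certificate**, by `dbnLowAllT_of_axisBarrier` at
`X = 6 000 001 000 000 ∈ [6·10¹², 6 000 350 665 599]`.  PROOF-OF-DATA; worth 0 toward RH; nothing here bears on
the truth of RH. [cite: Polymath2019, Prop. 3.3] [cite: PlattTrudgianBLMS2021, Thm. 1, Cor. 2] -/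
theorem dbnLowAllT_of_certificate (h₁ : platt_trudgian_numerical_rh) (h₂ : platt_trudgian)
    (hc : AxisBarrierCertificate) : DBN.DbnLowAllT :=
  dbnLowAllT_of_axisBarrier h₁ h₂ (X := 6000001000000) (by norm_num) (by norm_num)
    (axisBarrier_of_certificate h₁ hc)

/-- The same with F3 `Polymath15.table1_row2` in place of `platt_trudgian` (`platt_trudgian_of_numerics`).
[cite: Polymath2019, §10, Table 1 (row 2)] [cite: PlattTrudgianBLMS2021, Thm. 1] -/
theorem dbnLowAllT_of_certificate_of_numerics (h₁ : platt_trudgian_numerical_rh)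
    (h₃ : Polymath15.table1_row2) (hc : AxisBarrierCertificate) : DBN.DbnLowAllT :=
  dbnLowAllT_of_certificate h₁ (platt_trudgian_of_numerics h₁ h₃) hc

end Summit.RiemannHypothesis.RiemannHypothesis.Theorems.DbnTheory

end
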